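import Mathlib.Data.Nat.Choose.Central
import Mathlib.Tactic
import Literature.NumberTheory.Irrationality.BrownZudilin2022.TotallySymmetric
import Literature.NumberTheory.LFunctions.SchoenfeldPsiSmall
import HarnessLib

/-!
# ζ(5) search — kernel certificates for the totally symmetric cellular family

HONEST FRAMING: systematic search; no irrationality claim unless certified.

Cell `pub-zeta5` (summit KontsevichZagierPeriods, topic Zeta5Search), seat P1. The family is the totally
symmetric Brown–Zudilin cellular integral on `M_{0,8}` = Zudilin's 2002 third-order recursion for `ζ(5)`;
its published DATA are typed in `Literature.NumberTheory.Irrationality.BrownZudilin2022.TotallySymmetric`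
(`Q` = eq. (7), the recursion `c₃,c₂,c₁,c₀`/`SolvesRec`, the solutions `Qsol, P, Phat`, `charPoly`) and
`Literature.NumberTheory.Irrationality.Zudilin2002.Recursion` (`q, p, ptilde`, Theorem 1 as named facts).
This file adds what WE certify, by exact computation INSIDE THE KERNEL (`decide +kernel`; no
`native_decide`, no floating point), following the checker + soundness pattern of
`Literature.NumberTheory.LFunctions.SchoenfeldPsiSmall`:

* `Qf`, `Qf_eq_Q` — a kernel-friendly evaluator of `Q` (binomials by descending factorials, sums by
  structural recursion), PROVED equal to `Q`.
* **Certificate 1** `Q_recursion` — the binomial sums `Q_n` satisfy the Brown–Zudilin recursion for every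
  `2 ≤ n ≤ 30` (the named fact `BrownZudilin2022.Q_solvesRec` restricted to that range, now kernel-checked);
  `Q_eq_Qsol` — hence `Q_n = Qsol_n` (the recursion solution from `1, 21, 2989`) for `n ≤ 31`.
* **Certificate 2** `denominators` — for every `1 ≤ n ≤ 50`, with `d_n = lcm(1,…,n)`:
  `12·d_n⁵·P_n ∈ ℤ`, `2·d_n²·d_{2n}·P̂_n ∈ ℤ`, `2·binom(2n,n)·d_n⁵·P_n ∈ ℤ`, `2·binom(2n,n)·d_n³·P̂_n ∈ ℤ`;
  `zudilin_display6` — equivalently Zudilin's display (6) (`q_n ∈ ℤ`, `2D_n⁵p_n ∈ ℤ`, `2D_n³p̃_n ∈ ℤ`),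
  which the source states as the outcome of calculations, holds for `1 ≤ n ≤ 50`.
* **Certificate 2⁻** `bz_display6_fails` — Brown–Zudilin's display (6) AS PRINTED (`d_n⁵P_n ∈ ℤ`,
  `d_n²d_{2n}P̂_n ∈ ℤ`) fails for every `1 ≤ n ≤ 50` (e.g. `P₁ = 87/4`); the constant factors `12`, `2`
  above repair it on that range. Asymptotic statements (worthiness `0.77795976…`) are unaffected.

Margin bookkeeping for the cell (`CRITERIA.md`, `Criteria.lean`): decay rate of the `ζ(5)`-forms
`c = -log|λ₂| = 2.47237372…` (named fact `BrownZudilin2022.rates` / Zudilin 2002 Thm 1), denominator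
rate `δ = 5` (type `d_n⁵`, PNT), savings `φ = 0`; margin `c + φ - δ = -2.52762628… < 0`: a certified
NEAR-MISS, not a certificate. Nothing here claims anything about `ζ(5)`.
-/

namespace Summit.KontsevichZagierPeriods.Zeta5Search.SymmetricFamily

open Finset
open Literature.NumberTheory.Irrationality
open Literature.NumberTheory.Irrationality.BrownZudilin2022

/-! ### A kernel-friendly evaluator for `Q` -/

/-- Binomial coefficient via the descending factorial, `n.descFactorial k / k!` — linear-time in the
kernel, unlike Pascal's recursion. -/
def chooseF (n k : ℕ) : ℕ := n.descFactorial k / k.factorial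

/-- `chooseF n k = n.choose k`. -/
theorem chooseF_eq (n k : ℕ) : chooseF n k = n.choose k :=
  (Nat.choose_eq_descFactorial_div_factorial n k).symm

/-- The summand of `Q n` at `(k₁, k₂)`, computed with `chooseF`. -/
def term (n k₁ k₂ : ℕ) : ℕ :=
  chooseF (n + k₁) n * chooseF n k₁ ^ 2 * (chooseF (n + k₂) n * chooseF n k₂ ^ 2 * chooseF (n + k₁ + k₂) n)

/-- `sumTo f m = f 0 + f 1 + ⋯ + f m` by structural recursion. -/
def sumTo (f : ℕ → ℕ) : ℕ → ℕ
  | 0 => f 0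
  | m + 1 => sumTo f m + f (m + 1)

/-- `sumTo f m = ∑_{k ≤ m} f k`. -/
theorem sumTo_eq (f : ℕ → ℕ) (m : ℕ) : sumTo f m = ∑ k ∈ range (m + 1), f k := by
  induction m with
  | zero => simp [sumTo]
  | succ m ih => rw [sumTo, ih, Finset.sum_range_succ _ (m + 1)]

/-- Kernel-friendly evaluator of `Q`. -/
def Qf (n : ℕ) : ℕ := sumTo (fun k₁ => sumTo (fun k₂ => term n k₁ k₂) n) n

/-- The evaluator computes Brown–Zudilin's `Q` (eq. (7)). -/
theorem Qf_eq_Q (n : ℕ) : Qf n = Q n := by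
  simp only [Qf, sumTo_eq, term, chooseF_eq, Q]

/-- `Q 0 = 1`. -/
theorem Q_zero : Q 0 = 1 := by rw [← Qf_eq_Q]; rfl
/-- `Q 1 = 21`. -/
theorem Q_one : Q 1 = 21 := by rw [← Qf_eq_Q]; rfl
/-- `Q 2 = 2989`. -/
theorem Q_two : Q 2 = 2989 := by rw [← Qf_eq_Q]; rfl

/-! ### Certificate 1: the recursion for `Q_n`, `2 ≤ n ≤ 30` -/

/-- One pass of the recursion check: at index `n` with window `w = (Q_{n-2}, Q_{n-1}, Q_n)`, compute
`Q_{n+1}`, test `c₃(n)Q_{n+1} - c₂(n)Q_n - c₁(n)Q_{n-1} + c₀(n)Q_{n-2} = 0` in `ℤ`, slide the window;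
`fuel` passes. -/
def recCheckAux : ℕ → ℕ → ℕ × ℕ × ℕ → Bool
  | _, 0, _ => true
  | n, fuel + 1, w =>
    (c₃ (n : ℤ) * (Qf (n + 1) : ℤ) - c₂ (n : ℤ) * (w.2.2 : ℤ) - c₁ (n : ℤ) * (w.2.1 : ℤ)
        + c₀ (n : ℤ) * (w.1 : ℤ) == 0)
      && recCheckAux (n + 1) fuel (w.2.1, w.2.2, Qf (n + 1))

/-- Soundness of `recCheckAux`: a passing check from a correct window gives the recursion on the range. -/
theorem recCheckAux_sound : ∀ (fuel n : ℕ) (w : ℕ × ℕ × ℕ), 2 ≤ n →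
    w = (Q (n - 2), Q (n - 1), Q n) → recCheckAux n fuel w = true →
    ∀ m, n ≤ m → m < n + fuel →
      c₃ (m : ℤ) * (Q (m + 1) : ℤ) - c₂ (m : ℤ) * (Q m : ℤ) - c₁ (m : ℤ) * (Q (m - 1) : ℤ)
        + c₀ (m : ℤ) * (Q (m - 2) : ℤ) = 0 := by
  intro fuel
  induction fuel with
  | zero => intro n w _ _ _ m h1 h2; omega
  | succ fuel ih =>
    intro n w hn hw h m h1 h2
    subst hw
    simp only [recCheckAux, Bool.and_eq_true, beq_iff_eq, Qf_eq_Q] at h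
    obtain ⟨hstep, hrest⟩ := h
    rcases Nat.lt_or_ge n m with hlt | hge
    · refine ih (n + 1) _ (by omega) ?_ hrest m hlt (by omega)
      simp only [Nat.add_sub_cancel, show n + 1 - 2 = n - 1 by omega]
    · have hm : m = n := by omega
      subst hm
      exact hstep

/-- **The kernel computation** (exact integer arithmetic, `decide +kernel`, default heartbeats): 29 passes of
the recursion check from `n = 2` with the window `(Q₀, Q₁, Q₂)`, i.e. the recursion for all `2 ≤ n ≤ 30`. -/
theorem recCheck_holds : recCheckAux 2 29 (Qf 0, Qf 1, Qf 2) = true := by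
  decide +kernel

/-- **Certificate 1 (kernel-checked, exact).** The binomial sums `Q_n` of Brown–Zudilin eq. (7) satisfy
their third-order recursion `c₃(n)Q_{n+1} - c₂(n)Q_n - c₁(n)Q_{n-1} + c₀(n)Q_{n-2} = 0` for every
`2 ≤ n ≤ 30`. (For all `n` this is the named fact `BrownZudilin2022.Q_solvesRec`.) -/
theorem Q_recursion {n : ℕ} (h2 : 2 ≤ n) (h30 : n ≤ 30) :
    c₃ (n : ℚ) * (Q (n + 1) : ℚ) - c₂ (n : ℚ) * (Q n : ℚ) - c₁ (n : ℚ) * (Q (n - 1) : ℚ)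
      + c₀ (n : ℚ) * (Q (n - 2) : ℚ) = 0 := by
  have hw : ((Qf 0, Qf 1, Qf 2) : ℕ × ℕ × ℕ) = (Q (2 - 2), Q (2 - 1), Q 2) := by simp [Qf_eq_Q]
  have h := recCheckAux_sound 29 2 _ le_rfl hw recCheck_holds n h2 (by omega)
  have h' := congrArg (Int.cast : ℤ → ℚ) h
  push_cast [cast_c₃, cast_c₂, cast_c₁, cast_c₀] at h'
  exact h'

/-- **Certificate 1′.** For `n ≤ 31` the binomial sum `Q_n` equals the recursion solution `Qsol_n` with the
printed initial values `1, 21, 2989`. -/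
theorem Q_eq_Qsol {n : ℕ} (hn : n ≤ 31) : (Q n : ℚ) = Qsol n := by
  induction n using Nat.strong_induction_on with
  | _ n ih =>
    rcases n with _ | _ | _ | m
    · simp [Q_zero, Qsol]
    · simp [Q_one, Qsol]
    · simp [Q_two, Qsol]
    · have hr := Q_recursion (n := m + 2) (by omega) (by omega)
      simp only [show m + 2 + 1 = m + 1 + 1 + 1 by omega, show m + 2 - 1 = m + 1 by omega,
        Nat.add_sub_cancel] at hr
      rw [ih (m + 2) (by omega) (by omega), ih (m + 1) (by omega) (by omega),
        ih m (by omega) (by omega)] at hr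
      have hs := recSol_step 1 21 2989 m
      have hc : c₃ ((m : ℚ) + 2) ≠ 0 := by
        have := c₃_ne_zero (n := m + 2) (by omega); push_cast at this; exact this
      unfold Qsol at hr ⊢
      push_cast at hr
      rw [show m + 1 + 1 + 1 = m + 3 by omega, hs]
      field_simp
      linear_combination hr

/-- On `n ≤ 31`, Zudilin's `q_n` is the integer `(-1)^{n+1} binom(2n,n) Q_n` (binomial sum). -/
theorem q_eq {n : ℕ} (hn : n ≤ 31) :
    Zudilin2002.q n = (-1) ^ (n + 1) * (Nat.centralBinom n : ℚ) * (Q n : ℚ) := by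
  rw [q_eq_gauge]; unfold BrownZudilin2022.gauge; rw [Q_eq_Qsol hn]

/-! ### Certificate 2: denominators, `1 ≤ n ≤ 50` -/

/-- Running `lcm(1, …, n)` by recursion (kernel-friendly). -/
def lcmTo : ℕ → ℕ
  | 0 => 1
  | n + 1 => Nat.lcm (n + 1) (lcmTo n)

/-- `lcmTo n = Nat.lcmUpto n`. -/
theorem lcmTo_eq (n : ℕ) : lcmTo n = Nat.lcmUpto n := by
  induction n with
  | zero => simp [lcmTo, Nat.lcmUpto]
  | succ n ih =>
    rw [lcmTo, ih, Literature.NumberTheory.LFunctions.SchoenfeldBound.lcmUpto_succ]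

/-- Boolean integrality test on the reduced denominator. -/
def isIntB (x : ℚ) : Bool := x.den == 1

/-- `isIntB x = true` produces an integer equal to `x`. -/
theorem exists_int_of_isIntB {x : ℚ} (h : isIntB x = true) : ∃ z : ℤ, (z : ℚ) = x :=
  ⟨x.num, (Rat.den_eq_one_iff x).mp (by simpa [isIntB] using h)⟩

/-- `isIntB x = false` means `x` is not an integer. -/
theorem not_exists_int_of_isIntB {x : ℚ} (h : isIntB x = false) : ¬ ∃ z : ℤ, (z : ℚ) = x := by
  rintro ⟨z, rfl⟩
  simp [isIntB] at h

/-- The denominator tests at index `n`, with `d = lcm(1..n)`, `d₂ = lcm(1..2n)`, `B = binom(2n,n)`: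
(i) `12d⁵P_n ∈ ℤ`, (ii) `2d²d₂P̂_n ∈ ℤ`, (iii) `2Bd⁵P_n ∈ ℤ`, (iv) `2Bd³P̂_n ∈ ℤ`, the NEGATIVE tests
(v) `d⁵P_n ∉ ℤ`, (vi) `d²d₂P̂_n ∉ ℤ`, and (vii) `Qsol_n ∈ ℤ`. -/
def denOK (n : ℕ) : Bool :=
  let d : ℚ := lcmTo n
  let d₂ : ℚ := lcmTo (2 * n)
  let B : ℚ := chooseF (2 * n) n
  isIntB (12 * d ^ 5 * P n) && isIntB (2 * d ^ 2 * d₂ * Phat n)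
    && isIntB (2 * B * d ^ 5 * P n) && isIntB (2 * B * d ^ 3 * Phat n)
    && !isIntB (d ^ 5 * P n) && !isIntB (d ^ 2 * d₂ * Phat n) && isIntB (Qsol n)

/-- All denominator tests for `n = s, …, s + fuel - 1`. -/
def denCheckAux : ℕ → ℕ → Bool
  | _, 0 => true
  | s, fuel + 1 => denOK s && denCheckAux (s + 1) fuel

/-- Soundness of `denCheckAux`. -/
theorem denCheckAux_sound : ∀ (fuel s : ℕ), denCheckAux s fuel = true →
    ∀ m, s ≤ m → m < s + fuel → denOK m = true := by
  intro fuel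
  induction fuel with
  | zero => intro s _ m h1 h2; omega
  | succ fuel ih =>
    intro s h m h1 h2
    simp only [denCheckAux, Bool.and_eq_true] at h
    rcases Nat.lt_or_ge s m with hlt | hge
    · exact ih (s + 1) h.2 m hlt (by omega)
    · have hm : m = s := by omega
      subst hm; exact h.1

/-- **The kernel computation** (exact rational arithmetic, `decide +kernel`, default heartbeats): all seven
tests pass for every `1 ≤ n ≤ 50`. -/
theorem denCheck_holds : denCheckAux 1 50 = true := by
  decide +kernel

/-- Unpacking a passed test at `n` into statements over `Nat.lcmUpto` and `Nat.centralBinom`. -/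
theorem denOK_spec {n : ℕ} (h : denOK n = true) :
    (∃ z : ℤ, (z : ℚ) = 12 * (Nat.lcmUpto n : ℚ) ^ 5 * P n)
    ∧ (∃ z : ℤ, (z : ℚ) = 2 * (Nat.lcmUpto n : ℚ) ^ 2 * (Nat.lcmUpto (2 * n) : ℚ) * Phat n)
    ∧ (∃ z : ℤ, (z : ℚ) = 2 * (Nat.centralBinom n : ℚ) * (Nat.lcmUpto n : ℚ) ^ 5 * P n)
    ∧ (∃ z : ℤ, (z : ℚ) = 2 * (Nat.centralBinom n : ℚ) * (Nat.lcmUpto n : ℚ) ^ 3 * Phat n)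
    ∧ (¬ ∃ z : ℤ, (z : ℚ) = (Nat.lcmUpto n : ℚ) ^ 5 * P n)
    ∧ (¬ ∃ z : ℤ, (z : ℚ) = (Nat.lcmUpto n : ℚ) ^ 2 * (Nat.lcmUpto (2 * n) : ℚ) * Phat n)
    ∧ (∃ z : ℤ, (z : ℚ) = Qsol n) := by
  simp only [denOK, Bool.and_eq_true, Bool.not_eq_true', lcmTo_eq, chooseF_eq,
    ← Nat.centralBinom_eq_two_mul_choose] at h
  obtain ⟨⟨⟨⟨⟨⟨h1, h2⟩, h3⟩, h4⟩, h5⟩, h6⟩, h7⟩ := h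
  exact ⟨exists_int_of_isIntB h1, exists_int_of_isIntB h2, exists_int_of_isIntB h3,
    exists_int_of_isIntB h4, not_exists_int_of_isIntB h5, not_exists_int_of_isIntB h6,
    exists_int_of_isIntB h7⟩

/-- **Certificate 2 (denominators, kernel-checked, exact).** For every `1 ≤ n ≤ 50`, with `d_n = lcm(1,…,n)`:
`12·d_n⁵·P_n ∈ ℤ`, `2·d_n²·d_{2n}·P̂_n ∈ ℤ`, `2·binom(2n,n)·d_n⁵·P_n ∈ ℤ`, `2·binom(2n,n)·d_n³·P̂_n ∈ ℤ`. -/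
theorem denominators {n : ℕ} (h1 : 1 ≤ n) (h50 : n ≤ 50) :
    (∃ z : ℤ, (z : ℚ) = 12 * (Nat.lcmUpto n : ℚ) ^ 5 * P n)
    ∧ (∃ z : ℤ, (z : ℚ) = 2 * (Nat.lcmUpto n : ℚ) ^ 2 * (Nat.lcmUpto (2 * n) : ℚ) * Phat n)
    ∧ (∃ z : ℤ, (z : ℚ) = 2 * (Nat.centralBinom n : ℚ) * (Nat.lcmUpto n : ℚ) ^ 5 * P n)
    ∧ (∃ z : ℤ, (z : ℚ) = 2 * (Nat.centralBinom n : ℚ) * (Nat.lcmUpto n : ℚ) ^ 3 * Phat n) := by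
  have h := denOK_spec (denCheckAux_sound 50 1 denCheck_holds n h1 (by omega))
  exact ⟨h.1, h.2.1, h.2.2.1, h.2.2.2.1⟩

/-- **Zudilin's display (6), kernel-checked for `1 ≤ n ≤ 50`** (Mat. Zametki 72 (2002), eq. (6), stated
there as the outcome of calculations): `q_n ∈ ℤ`, `2D_n⁵p_n ∈ ℤ`, `2D_n³p̃_n ∈ ℤ` (`D_n = lcm(1,…,n)`),
via the proved gauge `q_n, p_n, p̃_n = (-1)^{n+1}binom(2n,n)·(Q_n, P_n, P̂_n)`. -/
theorem zudilin_display6 {n : ℕ} (h1 : 1 ≤ n) (h50 : n ≤ 50) :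
    (∃ z : ℤ, (z : ℚ) = Zudilin2002.q n)
    ∧ (∃ z : ℤ, (z : ℚ) = 2 * (Nat.lcmUpto n : ℚ) ^ 5 * Zudilin2002.p n)
    ∧ (∃ z : ℤ, (z : ℚ) = 2 * (Nat.lcmUpto n : ℚ) ^ 3 * Zudilin2002.ptilde n) := by
  have h := denOK_spec (denCheckAux_sound 50 1 denCheck_holds n h1 (by omega))
  obtain ⟨-, -, ⟨z₁, hz₁⟩, ⟨z₂, hz₂⟩, -, -, ⟨z₀, hz₀⟩⟩ := h
  refine ⟨⟨(-1) ^ (n + 1) * (Nat.centralBinom n : ℤ) * z₀, ?_⟩,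
    ⟨(-1) ^ (n + 1) * z₁, ?_⟩, ⟨(-1) ^ (n + 1) * z₂, ?_⟩⟩
  · rw [q_eq_gauge]; unfold BrownZudilin2022.gauge; push_cast; rw [hz₀]
  · rw [p_eq_gauge]; unfold BrownZudilin2022.gauge; push_cast; rw [hz₁]; ring
  · rw [ptilde_eq_gauge]; unfold BrownZudilin2022.gauge; push_cast; rw [hz₂]; ring

/-- **Certificate 2⁻ (a correction to the printed record, kernel-checked).** Brown–Zudilin,
arXiv:2210.03391v3, display (6), prints `Q_n, d_n²d_{2n}P̂_n, d_n⁵P_n ∈ ℤ for n = 0, 1, 2, …` with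
`P₁ = 87/4`, `P̂₁ = 101/4`; AS PRINTED this fails for every `1 ≤ n ≤ 50`: `d_n⁵P_n ∉ ℤ` and
`d_n²d_{2n}P̂_n ∉ ℤ`. (`denominators` gives the inclusions that do hold, with the constant factors `12` and
`2`; limits and worthiness in the source are unaffected.) -/
theorem bz_display6_fails {n : ℕ} (h1 : 1 ≤ n) (h50 : n ≤ 50) :
    (¬ ∃ z : ℤ, (z : ℚ) = (Nat.lcmUpto n : ℚ) ^ 5 * P n)
    ∧ (¬ ∃ z : ℤ, (z : ℚ) = (Nat.lcmUpto n : ℚ) ^ 2 * (Nat.lcmUpto (2 * n) : ℚ) * Phat n) := by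
  have h := denOK_spec (denCheckAux_sound 50 1 denCheck_holds n h1 (by omega))
  exact ⟨h.2.2.2.2.1, h.2.2.2.2.2.1⟩

/-- The smallest instance by hand: `d₁ = 1` and `P₁ = 87/4`, so `d₁⁵P₁ ∉ ℤ`. -/
theorem bz_display6_fails_one : ¬ ∃ z : ℤ, (z : ℚ) = (Nat.lcmUpto 1 : ℚ) ^ 5 * P 1 := by
  rintro ⟨z, hz⟩
  have hP : P 1 = 87 / 4 := rfl
  have hd : Nat.lcmUpto 1 = 1 := by simp [Nat.lcmUpto]
  rw [hP, hd] at hz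
  push_cast at hz
  have h4 : (4 * z : ℤ) = 87 := by
    have : (4 * z : ℚ) = 87 := by rw [hz]; ring
    exact_mod_cast this
  omega

end Summit.KontsevichZagierPeriods.Zeta5Search.SymmetricFamily
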